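import Mathlib
import HarnessLib
import Literature.MathematicalPhysics.QuantumLattice.HubbardEffectiveActionCTSymmetry
import Literature.MathematicalPhysics.QuantumLattice.HubbardTorusCurrentParity
import Summits.HubbardSuperconductivity.HubbardSuperconductivity.Theorems.KLProgrammeKLRegimeSplitValueIdentification

/-!
# Route `KLProgramme` — crux K3, ENGINE child (`KLRegimeEngineV7`, stmt-HubbardSuperconductivity-19662): the point group `D₄` and
# parity on the quartic running couplings — `λ_n^{σσ'}(γk₁,γk₂,γk₃) = λ_n^{σσ'}(k₁,k₂,k₃)`, `λ_n^{σσ'}(−k) = λ_n^{σσ'}(k)`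

Cell gate-hubbard-kl, seat p3 (g4); companion of `KLProgrammeKLRegimeEngineSelfEnergyGeometric.lean` (the same for the self-energy),
`…EngineQuarticSpinWard.lean` (`SU(2)`), `…EngineQuarticCrossing.lean` (time reversal).  From the tree's
`kernel_hubbardEffectiveActionCT_d4Field` (`Literature/…/HubbardEffectiveActionCTSymmetry.lean`, BGM 2006 §2.1 (4)) and the
additivity of the `D₄` action on the torus (`d4Site_add`, `d4Site_neg`, `d4Site_r_two`):
* **`klQuarticValue_d4Site`** — `λ_n^{σσ'}(γk₁, γk₂, γk₃) = λ_n^{σσ'}(k₁, k₂, k₃)` for every `γ ∈ D₄`;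
* **`klQuarticValue_neg`** — `λ_n^{σσ'}(−k₁, −k₂, −k₃) = λ_n^{σσ'}(k₁, k₂, k₃)` (`γ = r²`).
Everything is proved; no definitions.
-/

noncomputable section

namespace Summit.HubbardSuperconductivity.HubbardSuperconductivity.Theorems.KLRegimeSplit

set_option linter.dupNamespace false -- summit = problem name (single-conjunct summit), D-0017

open Literature.MathematicalPhysics.QuantumLattice Literature.Probability.LatticeModels Finset
open Summit.HubbardSuperconductivity.HubbardSuperconductivity.Theorems.KLProgrammeLegKernels

section Model

variable (L M : ℕ) [NeZero L] [NeZero M]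

/-- **`D₄` covariance of the quartic running couplings**: `λ_n^{σσ'}(γk₁, γk₂, γk₃) = λ_n^{σσ'}(k₁, k₂, k₃)` for every `γ ∈ D₄`,
scale `n` and all parameters (the transfer momentum `k₁ − k₂ + k₃` is rotated along, `D₄` acting additively). -/
theorem klQuarticValue_d4Site (β U μ : ℝ) (K : TrigPolyC4v) (n : ℕ) (γ : DihedralGroup 4) (σ σ' : Fin 2) (k₁ k₂ k₃ : TorusSite 2 L) :
    klQuarticValue L M β U μ K n σ σ' (d4Site γ k₁) (d4Site γ k₂) (d4Site γ k₃) = klQuarticValue L M β U μ K n σ σ' k₁ k₂ k₃ := by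
  have h4 : d4Site γ k₁ - d4Site γ k₂ + d4Site γ k₃ = d4Site γ (k₁ - k₂ + k₃) := by
    rw [sub_eq_add_neg, sub_eq_add_neg, d4Site_add, d4Site_add, d4Site_neg]
  simp only [klQuarticValue, vertexFn, klEffectiveAction, h4]
  congr 1
  have h := kernel_hubbardEffectiveActionCT_d4Field L M γ β U μ K (klScale klE0 n) 4
    ![(((omega0 M, k₁), σ), 0), (((omega0 M, k₂), σ), 1), ((((omega0 M).rev, k₃), σ'), 0),
      ((((omega0 M).rev, k₁ - k₂ + k₃), σ'), 1)]
  have hX : ((Equiv.prodCongr (Equiv.prodCongr (Equiv.prodCongr (Equiv.refl (MatsubaraIdx M)) (d4SitePerm (L := L) γ))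
      (Equiv.refl (Fin 2))) (Equiv.refl (Fin 2))) ∘
        (![(((omega0 M, k₁), σ), 0), (((omega0 M, k₂), σ), 1), ((((omega0 M).rev, k₃), σ'), 0),
          ((((omega0 M).rev, k₁ - k₂ + k₃), σ'), 1)] : Fin 4 → HubbardFieldIdx L M)) =
      ![(((omega0 M, d4Site γ k₁), σ), 0), (((omega0 M, d4Site γ k₂), σ), 1), ((((omega0 M).rev, d4Site γ k₃), σ'), 0),
        ((((omega0 M).rev, d4Site γ (k₁ - k₂ + k₃)), σ'), 1)] := by
    funext i; fin_cases i <;> rfl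
  rw [hX] at h
  exact h

/-- **Parity of the quartic running couplings**: `λ_n^{σσ'}(−k₁, −k₂, −k₃) = λ_n^{σσ'}(k₁, k₂, k₃)` (the rotation by `π`). -/
theorem klQuarticValue_neg (β U μ : ℝ) (K : TrigPolyC4v) (n : ℕ) (σ σ' : Fin 2) (k₁ k₂ k₃ : TorusSite 2 L) :
    klQuarticValue L M β U μ K n σ σ' (-k₁) (-k₂) (-k₃) = klQuarticValue L M β U μ K n σ σ' k₁ k₂ k₃ := by
  rw [← d4Site_r_two k₁, ← d4Site_r_two k₂, ← d4Site_r_two k₃]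
  exact klQuarticValue_d4Site L M β U μ K n (DihedralGroup.r 2) σ σ' k₁ k₂ k₃

end Model

end Summit.HubbardSuperconductivity.HubbardSuperconductivity.Theorems.KLRegimeSplit

end
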